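import Summits.BirchSwinnertonDyer.Rank1Residual.ManinAdditive.ShimuraFiveModuli
import HarnessLib

/-!
# E-es-240 `KubertTateFiveSignAtFiveLaw` is a theorem: the sign law at `5` on `X₁(5)`
# (cell bsd-f2-manin, es g44 ROAD δ part 5; MEMO-es §67.3)

For coprime integers `m, n` with the Tate normal form `E_{m,n} = kubertTateFive m n` elliptic and additive at `5`:
`w₅(E_{m,n}) = −1 ⟺ m ≡ 18n (mod 25)`.

* §1 KODAIRA II at `p ≥ 5`: an integral equation with `ord_p Δ = 2` and `p ∣ c₄` is minimal and additive at `p`, potentially good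
  (`ord_p j ≥ 0`), with Serre's semistability defect `e = 12 / gcd(12, 2) = 6`; Rohrlich: `w_p = (−1/p) = χ₄(p)`
  (`localRootNumberAt_baseChange_int_eq_χ₄_of_Δ_eq`); at `p = 5`: `w₅ = +1`.  (The Kodaira III twin, `ord_p Δ = 3 ⟹ w_p = (−2/p)`,
  is `localRootNumberAt_baseChange_int_eq_χ₈'_of_Δ_eq` of `ManinLocalTwoThreeShimuraFiveFamilyRootNumber`.)
* §2 RESIDUE CLASSES ON `X₁(5)`: `c₄(E_{m,n}) = (m − 3n)⁴ + 5·(−8m²n² + 24mn³ − 16n⁴)`; additive at `5` ⟹ `5 ∣ c₄` ⟹ `m = 3n + 5k`,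
  `5 ∤ mn`; `Δ = m⁵n⁵Q`, `Q(3n + 5k, n) = 25(k² − kn − n²)` and `k² − kn − n² = (k − 3n)² + 5n(k − 2n)` (tree
  `KubertTateFiveMinimalModel`): `ord₅Δ = 3` iff `k ≡ 3n (mod 5)` iff `25 ∣ m − 18n`, else `ord₅Δ = 2`.
* §3 **`kubertTateFiveSignAtFiveLaw_holds : KubertTateFiveSignAtFiveLaw`** (E-es-240).  It EXPLAINS E-es-238: on the Vélu side the same two
  classes are II* / III, and fifth powers `u⁵ ≡ 3d⁵ (mod 5)` satisfy `u⁵ ≡ 243d⁵ ≡ 18d⁵ (mod 25)` automatically.  (Statements are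
  on the integral model `(kubertTateFive m n).baseChange ℚ`; the tree's rational model `kubertTateFive (m : ℚ) (n : ℚ)` is the same curve by
  `map_kubertTateFive` + `eq_intCast`.)
BSD is not proved here; C2/C3 untouched.
[cite: Rohrlich1993Compositio, Prop. 2 (iv)] [cite: Serre1972, §5.6] [cite: SilvermanAEC2009, VII.1 Prop. 1.3, Remark 1.1; VII.5 Prop. 5.1]
[cite: Kubert1976, Table 3 (N = 5)] [cite: Knapp1993, V.5 (5.31)]
-/

set_option autoImplicit false

set_option linter.dupNamespace false

noncomputable section

open WeierstrassCurve Literature.NumberTheory.EllipticCurves IsDedekindDomain Rat.HeightOneSpectrum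
open Summit.BirchSwinnertonDyer.Rank1Residual.ManinAdditive Summit.BirchSwinnertonDyer.Rank1Residual.ManinAdditive.EsG43
open Summit.BirchSwinnertonDyer.Rank1Residual.ManinAdditive.EsG44

namespace Summit.BirchSwinnertonDyer.BirchSwinnertonDyer.Theorems.ManinLocalTwoThree.ShimuraFive

/-! ### §1. Kodaira type II at `p ≥ 5`: `ord_p Δ = 2` and `p ∣ c₄` give `w_p = χ₄(p) = (−1/p)` -/

/-- **`w_p = (−1/p)` for an integral equation with `ord_p Δ = 2`, `p ∣ c₄`, `p ≥ 5`.**  Such an equation is minimal at `p`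
(`p¹² ∤ Δ`) and additive there (`p ∣ c₄`, `p ∣ Δ`), with `ord_p Δ_min = 2` and `ord_p j = 3 ord_p c₄ − 2 ≥ 0` (potentially good);
Serre's formula for `p ≥ 5` gives the semistability defect `e = 12 / gcd(12, 2) = 6` (Kodaira II) and Rohrlich's Prop. 2 (iv) gives
`W(E/ℚ_p) = (−1/p) = χ₄(p)`.  [cite: Rohrlich1993Compositio, Prop. 2 (iv)] [cite: Serre1972, §5.6]
[cite: SilvermanAEC2009, VII.1 Prop. 1.3 and Remark 1.1] -/
theorem localRootNumberAt_baseChange_int_eq_χ₄_of_Δ_eq {p : ℕ} [Fact p.Prime] (hp5 : 5 ≤ p)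
    (W₁ : WeierstrassCurve ℤ) [(W₁.baseChange ℚ).IsElliptic] {D : ℤ}
    (hΔ : W₁.Δ = (p : ℤ) ^ 2 * D) (hD : ¬ (p : ℤ) ∣ D) (hc : (p : ℤ) ∣ W₁.c₄) :
    (W₁.baseChange ℚ).localRootNumberAt ((primesEquiv (R := ℤ)).symm ⟨p, Fact.out⟩) = ZMod.χ₄ p := by
  have hp : p.Prime := Fact.out
  have hv : ((primesEquiv (R := ℤ) ((primesEquiv (R := ℤ)).symm ⟨p, Fact.out⟩) : Nat.Primes) : ℕ) = p :=
    congrArg Subtype.val ((primesEquiv (R := ℤ)).apply_symm_apply ⟨p, Fact.out⟩)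
  have hgen : natGenerator ((primesEquiv (R := ℤ)).symm ⟨p, Fact.out⟩) = p := hv
  have hp0 : (p : ℤ) ≠ 0 := by exact_mod_cast hp.ne_zero
  have hΔ0 : W₁.Δ ≠ 0 := Δ_ne_zero_of_isElliptic_baseChange_int W₁
  have h2 : (p : ℤ) ^ 2 ∣ W₁.Δ := ⟨D, hΔ⟩
  have h3 : ¬ (p : ℤ) ^ 3 ∣ W₁.Δ := by
    rw [hΔ, pow_succ]
    exact fun h ↦ hD ((mul_dvd_mul_iff_left (pow_ne_zero 2 hp0)).mp h)
  have h12 : ¬ (p : ℤ) ^ 12 ∣ W₁.Δ := fun h ↦ h3 ((pow_dvd_pow (p : ℤ) (by norm_num)).trans h)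
  have h1 : (p : ℤ) ∣ W₁.Δ := (dvd_pow_self (p : ℤ) two_ne_zero).trans h2
  -- minimal and additive at `p`
  have hmin : (W₁.baseChange ℚ).IsMinimalAt ((primesEquiv (R := ℤ)).symm ⟨p, Fact.out⟩) :=
    isMinimalAt_baseChange_int_of_not_pow_dvd_Δ (by rw [hgen]; exact h12)
  have hadd : (W₁.baseChange ℚ).HasAdditiveReductionAt ((primesEquiv (R := ℤ)).symm ⟨p, Fact.out⟩) := by
    rw [hasAdditiveReductionAt_iff_of_isMinimalAt hmin, baseChange_int_Δ, baseChange_int_c₄,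
      Literature.NumberTheory.EllipticCurves.Rat.valuation_intCast_lt_one_iff,
      Literature.NumberTheory.EllipticCurves.Rat.valuation_intCast_lt_one_iff, hgen]
    exact ⟨h1, hc⟩
  -- `ord_p Δ_min = 2`
  have hord : (W₁.baseChange ℚ).ordMinimalDiscriminant ((primesEquiv (R := ℤ)).symm ⟨p, Fact.out⟩) = 2 := by
    have hval := valuation_Δ_eq_of_isMinimalAt_holds ((primesEquiv (R := ℤ)).symm ⟨p, Fact.out⟩)
      (W₁.baseChange ℚ) hmin
    rw [baseChange_int_Δ] at hval
    have key : ∀ k : ℕ, (natGenerator ((primesEquiv (R := ℤ)).symm ⟨p, Fact.out⟩) : ℤ) ^ k ∣ W₁.Δ ↔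
        k ≤ (W₁.baseChange ℚ).ordMinimalDiscriminant ((primesEquiv (R := ℤ)).symm ⟨p, Fact.out⟩) := by
      intro k
      rw [← Literature.NumberTheory.EllipticCurves.Rat.valuation_intCast_le_exp_iff _ W₁.Δ k, hval,
        WithZero.exp_le_exp, neg_le_neg_iff, Nat.cast_le]
    have h2' := (key 2).mp (by rw [hgen]; exact h2)
    have h3' : ¬ 3 ≤ (W₁.baseChange ℚ).ordMinimalDiscriminant ((primesEquiv (R := ℤ)).symm ⟨p, Fact.out⟩) :=
      fun h ↦ h3 (by have := (key 3).mpr h; rwa [hgen] at this)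
    omega
  -- `ord_p j ≥ 0`
  have hj : 0 ≤ padicValRat p (W₁.baseChange ℚ).j := by
    have hjW : (W₁.baseChange ℚ).j = ((W₁.c₄ : ℚ)) ^ 3 / (W₁.Δ : ℚ) := by
      rw [WeierstrassCurve.j, Units.val_inv_eq_inv_val, coe_Δ', baseChange_int_c₄, baseChange_int_Δ, div_eq_inv_mul]
    rw [hjW]
    by_cases hc0 : W₁.c₄ = 0
    · rw [hc0]; simp
    have hvc : 1 ≤ padicValInt p W₁.c₄ :=
      ((padicValInt_dvd_iff 1 W₁.c₄).mp (by rwa [pow_one])).resolve_left hc0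
    have hvΔ : padicValInt p W₁.Δ ≤ 2 := by
      by_contra hlt
      exact h3 ((padicValInt_dvd_iff 3 W₁.Δ).mpr (Or.inr (by omega)))
    have hc0' : ((W₁.c₄ : ℚ)) ^ 3 ≠ 0 := pow_ne_zero 3 (by exact_mod_cast hc0)
    have hΔ0' : (W₁.Δ : ℚ) ≠ 0 := by exact_mod_cast hΔ0
    rw [padicValRat.div hc0' hΔ0', padicValRat.pow, padicValRat.of_int, padicValRat.of_int]
    push_cast
    omega
  -- Serre: `e = 12 / gcd(12, 2) = 6`; Rohrlich: `w_p = χ₄(p)`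
  have he : (W₁.baseChange ℚ).semistabilityDefectAt p = 6 := by
    rw [(W₁.baseChange ℚ).semistabilityDefectAt_eq_twelve_div_gcd_of_five_le
      ((primesEquiv (R := ℤ)).symm ⟨p, Fact.out⟩) hv hp5 hj, hord]
    decide
  have hadd' := ((W₁.baseChange ℚ).hasAdditiveReduction_padic_iff_hasAdditiveReductionAt_int ⟨p, Fact.out⟩).mpr hadd
  rw [(W₁.baseChange ℚ).localRootNumberAt_primesEquiv_symm_eq (R := ℤ) ⟨p, Fact.out⟩]
  exact (W₁.baseChange ℚ).localRootNumber_padic_eq_χ₄_of_semistabilityDefectAt_eq_two_or_six hp5 hadd' (Or.inr he)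

/-- **At `p = 5`**: an integral equation with `ord₅ Δ = 2` and `5 ∣ c₄` has `w₅ = χ₄(5) = (−1/5) = +1` (Kodaira II, `e = 6`).
[cite: Rohrlich1993Compositio, Prop. 2 (iv)] [cite: Serre1972, §5.6] -/
theorem localRootNumberAt_five_baseChange_int_eq_one (W₁ : WeierstrassCurve ℤ) [(W₁.baseChange ℚ).IsElliptic]
    {D : ℤ} (hΔ : W₁.Δ = 5 ^ 2 * D) (hD : ¬ (5 : ℤ) ∣ D) (hc : (5 : ℤ) ∣ W₁.c₄) :
    (W₁.baseChange ℚ).localRootNumberAt ((primesEquiv (R := ℤ)).symm ⟨5, by norm_num⟩) = 1 := by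
  haveI : Fact (Nat.Prime 5) := ⟨by norm_num⟩
  have h := localRootNumberAt_baseChange_int_eq_χ₄_of_Δ_eq (p := 5) le_rfl W₁ (D := D)
    (by exact_mod_cast hΔ) (by exact_mod_cast hD) (by exact_mod_cast hc)
  rw [ZMod.χ₄_nat_eq_if_mod_four] at h
  norm_num at h
  exact h

/-! ### §2. Residue classes on `X₁(5)` -/

section Ring

variable {R : Type*} [CommRing R] (m n : R)

/-- `c₄(E_{m,n}) = (m − 3n)⁴ + 5·(−8m²n² + 24mn³ − 16n⁴)`: `c₄ ≡ (m − 3n)⁴ (mod 5)`. [cite: SilvermanAEC2009, III.1 (c₄)] -/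
theorem kubertTateFive_c₄_eq_pow_four_add :
    (kubertTateFive m n).c₄ = (m - 3 * n) ^ 4 + 5 * (-8 * m ^ 2 * n ^ 2 + 24 * m * n ^ 3 - 16 * n ^ 4) := by
  rw [kubertTateFive_c₄]; ring

end Ring

/-- For coprime `m, n`: additive reduction of `E_{m,n}` at `5` forces `5 ∣ c₄(E_{m,n})`, `m = 3n + 5k`, `5 ∤ n`, `5 ∤ m`.
[cite: SilvermanAEC2009, VII.5 Prop. 5.1] [cite: Kubert1976, Table 3 (N = 5)] -/
theorem kubertTateFive_residue_of_hasAdditiveReductionAt_five {m n : ℤ} (hcop : IsCoprime m n)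
    [((kubertTateFive m n).baseChange ℚ).IsElliptic]
    (hadd : ((kubertTateFive m n).baseChange ℚ).HasAdditiveReductionAt ((primesEquiv (R := ℤ)).symm ⟨5, by norm_num⟩)) :
    (5 : ℤ) ∣ (kubertTateFive m n).c₄ ∧ (∃ k : ℤ, m = 3 * n + 5 * k) ∧ ¬ (5 : ℤ) ∣ n ∧ ¬ (5 : ℤ) ∣ m := by
  have hgen : natGenerator ((primesEquiv (R := ℤ)).symm ⟨5, by norm_num⟩) = 5 :=
    Literature.NumberTheory.EllipticCurves.Rat.natGenerator_primesEquiv_symm ⟨5, by norm_num⟩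
  have hp5 : Prime (5 : ℤ) := Int.prime_iff_natAbs_prime.mpr (by norm_num)
  -- additive ⟹ `5 ∣ c₄`
  have h5c : (5 : ℤ) ∣ (kubertTateFive m n).c₄ := by
    by_contra h
    have hns := (((kubertTateFive m n).baseChange ℚ).not_isSemistableAt_iff_hasAdditiveReductionAt
      ((primesEquiv (R := ℤ)).symm ⟨5, by norm_num⟩)).mpr hadd
    exact hns (isSemistableAt_of_valuation_c₄_eq_one (isIntegralAt_baseChange_int _ _)
      (by rw [baseChange_int_c₄, Literature.NumberTheory.EllipticCurves.Rat.valuation_intCast_eq_one_iff, hgen]; exact h))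
  -- `5 ∣ (m − 3n)⁴`
  have h53 : (5 : ℤ) ∣ m - 3 * n := by
    have h := h5c
    rw [kubertTateFive_c₄_eq_pow_four_add] at h
    exact hp5.dvd_of_dvd_pow ((dvd_add_left (dvd_mul_right 5 _)).mp h)
  obtain ⟨k, hk⟩ := h53
  have hm : m = 3 * n + 5 * k := by linear_combination hk
  have h5n : ¬ (5 : ℤ) ∣ n := by
    intro h5n
    have h5m : (5 : ℤ) ∣ m := by
      rw [hm]; exact dvd_add (dvd_mul_of_dvd_right h5n 3) (dvd_mul_right 5 k)
    have hU := hcop.isUnit_of_dvd' h5m h5n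
    rw [Int.isUnit_iff] at hU
    omega
  have h5m : ¬ (5 : ℤ) ∣ m := by
    intro h5m
    have h3n : (5 : ℤ) ∣ 3 * n := by
      have h := dvd_sub h5m (dvd_mul_right 5 k)
      rwa [hm, add_sub_cancel_right] at h
    rcases hp5.dvd_mul.mp h3n with h | h
    · norm_num at h
    · exact h5n h
  exact ⟨h5c, ⟨k, hm⟩, h5n, h5m⟩

/-! ### §3. E-es-240: the sign law at `5` on `X₁(5)` -/

/-- **Kodaira III class.**  `(m, n) = 1`, `m = 3n + 5k`, `k ≡ 3n (mod 5)` (i.e. `m ≡ 18n (mod 25)`), additive at `5` ⟹ `w₅(E_{m,n}) = −1`: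
`Δ = 5³ · m⁵n⁵(5j² + 5jn + n²)` with the cofactor prime to `5`.  [cite: Rohrlich1993Compositio, Prop. 2 (iv)] [cite: SilvermanAEC2009, VII.1] -/
theorem localRootNumberAt_five_kubertTateFive_eq_neg_one {m n : ℤ} (hcop : IsCoprime m n)
    [((kubertTateFive m n).baseChange ℚ).IsElliptic]
    (hadd : ((kubertTateFive m n).baseChange ℚ).HasAdditiveReductionAt ((primesEquiv (R := ℤ)).symm ⟨5, by norm_num⟩))
    (h25 : (25 : ℤ) ∣ m - 18 * n) :
    ((kubertTateFive m n).baseChange ℚ).localRootNumberAt ((primesEquiv (R := ℤ)).symm ⟨5, by norm_num⟩) = -1 := by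
  have hp5 : Prime (5 : ℤ) := Int.prime_iff_natAbs_prime.mpr (by norm_num)
  obtain ⟨h5c, ⟨k, hm⟩, h5n, h5m⟩ := kubertTateFive_residue_of_hasAdditiveReductionAt_five hcop hadd
  -- `25 ∣ m − 18n = 5(k − 3n)` ⟹ `k = 3n + 5j`
  have hk3 : (5 : ℤ) ∣ k - 3 * n := by
    have e : m - 18 * n = 5 * (k - 3 * n) := by rw [hm]; ring
    rw [e, show (25 : ℤ) = 5 * 5 by norm_num] at h25
    exact (mul_dvd_mul_iff_left (by norm_num : (5 : ℤ) ≠ 0)).mp h25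
  obtain ⟨j, hj⟩ := hk3
  have hkj : k = 3 * n + 5 * j := by linear_combination hj
  have hΔ : (kubertTateFive m n).Δ = 5 ^ 3 * (m ^ 5 * n ^ 5 * (5 * j ^ 2 + 5 * j * n + n ^ 2)) := by
    rw [kubertTateFive_Δ, hm, hkj]; ring
  have hR : ¬ (5 : ℤ) ∣ 5 * j ^ 2 + 5 * j * n + n ^ 2 := by
    intro h
    have h2 : (5 : ℤ) ∣ n ^ 2 := by
      have e : 5 * j ^ 2 + 5 * j * n + n ^ 2 = 5 * (j ^ 2 + j * n) + n ^ 2 := by ring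
      rw [e] at h
      exact (dvd_add_right (dvd_mul_right 5 _)).mp h
    exact h5n (hp5.dvd_of_dvd_pow h2)
  have hD : ¬ (5 : ℤ) ∣ m ^ 5 * n ^ 5 * (5 * j ^ 2 + 5 * j * n + n ^ 2) := by
    intro h
    rcases hp5.dvd_mul.mp h with h | h
    · rcases hp5.dvd_mul.mp h with h | h
      · exact h5m (hp5.dvd_of_dvd_pow h)
      · exact h5n (hp5.dvd_of_dvd_pow h)
    · exact hR h
  exact localRootNumberAt_five_baseChange_int_eq_neg_one _ hΔ hD h5c

/-- **Kodaira II classes.**  `(m, n) = 1`, `m = 3n + 5k`, `k ≢ 3n (mod 5)` (i.e. `m ≢ 18n (mod 25)`), additive at `5` ⟹ `w₅(E_{m,n}) = +1`: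
`Δ = 5² · m⁵n⁵(k² − kn − n²)` with `k² − kn − n² = (k − 3n)² + 5n(k − 2n)` prime to `5`.
[cite: Rohrlich1993Compositio, Prop. 2 (iv)] [cite: SilvermanAEC2009, VII.1] -/
theorem localRootNumberAt_five_kubertTateFive_eq_one {m n : ℤ} (hcop : IsCoprime m n)
    [((kubertTateFive m n).baseChange ℚ).IsElliptic]
    (hadd : ((kubertTateFive m n).baseChange ℚ).HasAdditiveReductionAt ((primesEquiv (R := ℤ)).symm ⟨5, by norm_num⟩))
    (h25 : ¬ (25 : ℤ) ∣ m - 18 * n) :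
    ((kubertTateFive m n).baseChange ℚ).localRootNumberAt ((primesEquiv (R := ℤ)).symm ⟨5, by norm_num⟩) = 1 := by
  have hp5 : Prime (5 : ℤ) := Int.prime_iff_natAbs_prime.mpr (by norm_num)
  obtain ⟨h5c, ⟨k, hm⟩, h5n, h5m⟩ := kubertTateFive_residue_of_hasAdditiveReductionAt_five hcop hadd
  have hk3 : ¬ (5 : ℤ) ∣ k - 3 * n := by
    intro h
    apply h25
    have e : m - 18 * n = 5 * (k - 3 * n) := by rw [hm]; ring
    rw [e, show (25 : ℤ) = 5 * 5 by norm_num]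
    exact mul_dvd_mul_left 5 h
  have hΔ : (kubertTateFive m n).Δ = 5 ^ 2 * (m ^ 5 * n ^ 5 * (k ^ 2 - k * n - n ^ 2)) := by
    rw [kubertTateFive_Δ, hm]; ring
  have hK : ¬ (5 : ℤ) ∣ k ^ 2 - k * n - n ^ 2 := by
    intro h
    rw [normForm₅_eq_sq_add_five_mul] at h
    exact hk3 (hp5.dvd_of_dvd_pow ((dvd_add_left (dvd_mul_right 5 _)).mp h))
  have hD : ¬ (5 : ℤ) ∣ m ^ 5 * n ^ 5 * (k ^ 2 - k * n - n ^ 2) := by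
    intro h
    rcases hp5.dvd_mul.mp h with h | h
    · rcases hp5.dvd_mul.mp h with h | h
      · exact h5m (hp5.dvd_of_dvd_pow h)
      · exact h5n (hp5.dvd_of_dvd_pow h)
    · exact hK h
  exact localRootNumberAt_five_baseChange_int_eq_one _ hΔ hD h5c

/-- **E-es-240 `KubertTateFiveSignAtFiveLaw` HOLDS**: the sign law at `5` on `X₁(5)` — for coprime `m, n` with `E_{m,n}` elliptic and
additive at `5`, `w₅ = −1` iff `m ≡ 18n (mod 25)` (Kodaira III), else `w₅ = +1` (Kodaira II).
[cite: Rohrlich1993Compositio, Prop. 2 (iv)] [cite: Serre1972, §5.6] [cite: Kubert1976, Table 3 (N = 5)] -/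
theorem kubertTateFiveSignAtFiveLaw_holds : KubertTateFiveSignAtFiveLaw := by
  intro m n _ hcop hadd
  exact ⟨localRootNumberAt_five_kubertTateFive_eq_neg_one hcop hadd,
    localRootNumberAt_five_kubertTateFive_eq_one hcop hadd⟩

end Summit.BirchSwinnertonDyer.BirchSwinnertonDyer.Theorems.ManinLocalTwoThree.ShimuraFive

end
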